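import Summits.QuantumFields.YangMills.Theorems.BalabanLadderUVSeamRecColdWallBoxCeiling
import HarnessLib

/-!
# Crux `UVSeamRec` (stmt-QuantumFields-20043): GAUGE FIXING INSIDE THE FIBRE of a `ℤ⁴` Yang–Mills kernel with the identity exterior —
# the lower bound `e^{−8βr²#P_Λ} · φ_ρ(r)^{#(Λ ∖ T)} ≤ Z_Λ(β; 𝟙)` for every gauge-fixable link set `T ⊆ Λ`

Helper file (`--supports stmt-QuantumFields-20043`) of the LEAD seat `ym-spine-20043-p1` (gen 12).  Gen 11's cold-wall box ceiling
(`…ColdWallBoxCeiling.integral_wilsonBoundaryAction_ymSpecification_one_le`) restricts ALL links of `Λ` to the small ball and pays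
`φ_ρ(r)^{#Λ}`, whence a `log β` per link; the matching peeling upper bound only has `#Λ − #T` factors, `T` a maximal gauge tree.  This file
removes the mismatch: an ABSTRACT GAUGE-FIXING LEMMA in the fibre `G^Λ` of the kernel `γ_Λ(· | 𝟙)`.
* §1 `measurePreserving_conj_pi` — `w ↦ (a_ℓ w_ℓ c_ℓ⁻¹)_ℓ` preserves the product Haar measure (two-sided invariance of Haar on a compact group);
* §2 **`fibreIntegral_exp_neg_mul_one_ge_of_gauge`** — let `T ⊆ Λ` and let `g ζ : ℤ⁴ → G` be a gauge transformation depending measurably on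
  the inner configuration `ζ` ONLY THROUGH ITS `T`-COORDINATES, trivial at both ends of every exterior link, and killing the `T`-links of `ζ ∨ 𝟙`
  (`(g ζ · (ζ ∨ 𝟙))_ℓ = 1`, `ℓ ∈ T`).  Then for `β ≥ 0`, `r > 0`:
  `exp(−8βr²·#P_Λ) · φ_ρ(r)^{#(Λ ∖ T)} ≤ ∫ e^{−β S_Λ(ζ ∨ 𝟙)} dHaar^Λ(ζ)`.
  Proof: split `G^Λ = G^T × G^{Λ∖T}` (Mathlib `piEquivPiSubtypeProd`, measure preserving); in these coordinates `ζ ↦ (t, (g ζ · (ζ ∨ 𝟙))|_{Λ∖T})`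
  is a SKEW PRODUCT over the identity of `G^T` whose fibre maps are two-sided translations (`MeasurePreserving.skew_product`), hence Haar-measure
  preserving; the preimage of the box `{‖ρ(w_ℓ) − 1‖_F ≤ r ∀ ℓ ∉ T}` has measure `φ_ρ(r)^{#(Λ∖T)}`, and on it the gauge-fixed configuration has
  ALL links of `ℤ⁴` in the ball, so `S_Λ = S_Λ ∘ (gauge) ≤ 8r² #P_Λ` (`…ColdWallBoxCeiling.wilsonBoundaryAction_le_of_forall_norm_le`).
The cube's temporal comb (deep sites) instantiates it in the sequel `…ColdWallComb`; with the fibre peeling (`…FibrePeeling`) this gives the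
cold-wall box ceiling WITHOUT the log.  HONEST FRAMING: measure-preserving change of variables on a finite product of compact groups; nothing of
E0′, NT or the gap; not Clay.
-/

open MeasureTheory Finset
open scoped ENNReal Matrix Matrix.Norms.Frobenius
open Literature.MathematicalPhysics.QuantumFieldTheory (haarProbability)
open Literature.MathematicalPhysics.QuantumLattice
open Literature.Probability.LatticeModels (glueWith glueWith_apply_mem glueWith_apply_not_mem measurable_glueWith)

noncomputable section

namespace Summit.QuantumFields.YangMills.Cruxes.UVSeamRec.ClassicalResponse.ColdWall

/-! ### §1 Two-sided translations preserve the product Haar measure -/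

section Conj

variable {ι : Type*} [Fintype ι] {G : Type*} [Group G] [TopologicalSpace G] [IsTopologicalGroup G] [CompactSpace G]
  [MeasurableSpace G] [BorelSpace G]

/-- `y ↦ a y c⁻¹` preserves the normalised Haar measure of a compact group (left and right invariance). [folklore] -/
theorem measurePreserving_conj (a c : G) :
    MeasurePreserving (fun y : G => a * y * c⁻¹) (haarProbability G) (haarProbability G) :=
  (measurePreserving_mul_right (haarProbability G) c⁻¹).comp (measurePreserving_mul_left (haarProbability G) a)

/-- `w ↦ (a_ℓ w_ℓ c_ℓ⁻¹)_ℓ` preserves the product Haar measure `Haar^ι`. [folklore] -/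
theorem measurePreserving_conj_pi (a c : ι → G) :
    MeasurePreserving (fun w : ι → G => fun ℓ => a ℓ * w ℓ * (c ℓ)⁻¹)
      (Measure.pi fun _ : ι => haarProbability G) (Measure.pi fun _ : ι => haarProbability G) := by
  haveI : IsProbabilityMeasure (haarProbability G) :=
    ⟨by simpa [haarProbability] using Measure.haarMeasure_self (G := G) (K₀ := ⊤)⟩
  exact measurePreserving_pi (fun _ : ι => haarProbability G) (fun _ : ι => haarProbability G)
    (f := fun ℓ y => a ℓ * y * (c ℓ)⁻¹) fun ℓ => measurePreserving_conj (a ℓ) (c ℓ)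

end Conj

/-! ### §2 The gauge-fixed lower bound on the fibre integral -/

section Gauge

variable {N : ℕ} {G : Type*} [Group G] [TopologicalSpace G] [IsTopologicalGroup G] [CompactSpace G]
  [MeasurableSpace G] [BorelSpace G] [SecondCountableTopology G] (ρ : G →* Matrix (Fin N) (Fin N) ℂ)

/-- **GAUGE-FIXED LOWER BOUND ON THE COLD-WALL FIBRE INTEGRAL.**  Let `ρ` be a continuous unitary representation of the compact second-countable
group `G`, `Λ` and `T` finite link sets of `ℤ⁴` (in the application `T ⊆ Λ` is a gauge tree), and `g : G^Λ → (ℤ⁴ → G)` a family of gauge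
transformations such that
(i) `ζ ↦ g ζ x` is measurable for every site `x`; (ii) `g ζ` depends on `ζ` only through the coordinates in `T`; (iii) `g ζ` is trivial at both
endpoints of every link `e ∉ Λ`; (iv) the gauge transform of `ζ ∨ 𝟙` by `g ζ` is `1` on every link of `T`.  Then for `β ≥ 0` and `r > 0`:
`exp(−8βr²·#P_Λ) · φ_ρ(r)^{#(Λ ∖ T)} ≤ ∫ exp(−β S_Λ(ζ ∨ 𝟙)) dHaar^Λ(ζ)`, `φ_ρ(r) = Haar{‖ρ g − 1‖_F ≤ r}` — the gauge-fixed configuration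
has its `T`-links and exterior links equal to `1`, the map `ζ ↦ (ζ|_T, (g ζ · (ζ ∨ 𝟙))|_{Λ∖T})` preserves `Haar^Λ` (a skew product of two-sided
translations over `G^T`), and on the preimage of the link ball every plaquette touching `Λ` costs `≤ 8r²`. [folklore] -/
theorem fibreIntegral_exp_neg_mul_one_ge_of_gauge (hρ : Continuous ρ) (hρU : ∀ g, ρ g ∈ Matrix.unitaryGroup (Fin N) ℂ)
    (Λ T : Finset (ZdEdge 4)) (g : (↥Λ → G) → (Literature.Probability.LatticeModels.Site 4 → G))
    (hgm : ∀ x, Measurable fun ζ => g ζ x)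
    (hgT : ∀ ζ ζ' : ↥Λ → G, (∀ ℓ : ↥Λ, ℓ.1 ∈ T → ζ ℓ = ζ' ℓ) → g ζ = g ζ')
    (hgext : ∀ (ζ : ↥Λ → G) (e : ZdEdge 4), e ∉ Λ → g ζ e.1 = 1 ∧ g ζ (e.1 + Pi.single e.2 1) = 1)
    (hgfix : ∀ (ζ : ↥Λ → G) (ℓ : ZdEdge 4), ℓ ∈ T → gaugeTransformZd (g ζ) (glueWith Λ ζ (fun _ => 1)) ℓ = 1)
    {β : ℝ} (hβ : 0 ≤ β) {r : ℝ} (hr : 0 < r) :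
    Real.exp (-(8 * β * r ^ 2 * (plaquettesTouching Λ).card)) *
        (haarProbability G).real {g : G | ‖ρ g - 1‖ ≤ r} ^ (Λ \ T).card ≤
      ∫ ζ, Real.exp (-β * wilsonBoundaryAction ρ Λ (glueWith Λ ζ (fun _ => 1))) ∂(Measure.pi fun _ : ↥Λ => haarProbability G) := by
  classical
  -- measures
  set μ : Measure G := haarProbability G with hμ
  haveI hprob : IsProbabilityMeasure μ :=
    ⟨by simpa [hμ, haarProbability] using Measure.haarMeasure_self (G := G) (K₀ := ⊤)⟩
  set π₀ : Measure (↥Λ → G) := Measure.pi fun _ : ↥Λ => μ with hπ₀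
  haveI : IsProbabilityMeasure π₀ := by rw [hπ₀]; infer_instance
  set η₁ : LGConfig 4 G := fun _ => 1 with hη₁
  -- the gauge-fixed configuration
  set V : (↥Λ → G) → LGConfig 4 G := fun ζ => gaugeTransformZd (g ζ) (glueWith Λ ζ η₁) with hV
  have hVapply : ∀ (ζ : ↥Λ → G) (e : ZdEdge 4), V ζ e = g ζ e.1 * glueWith Λ ζ η₁ e * (g ζ (e.1 + Pi.single e.2 1))⁻¹ :=
    fun ζ e => rfl
  have hVext : ∀ (ζ : ↥Λ → G) (e : ZdEdge 4), e ∉ Λ → V ζ e = 1 := by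
    intro ζ e he
    rw [hVapply, glueWith_apply_not_mem _ _ _ he, (hgext ζ e he).1, (hgext ζ e he).2, hη₁]
    simp
  have hVT : ∀ (ζ : ↥Λ → G) (ℓ : ZdEdge 4), ℓ ∈ T → V ζ ℓ = 1 := fun ζ ℓ hℓ => hgfix ζ ℓ hℓ
  have hVmeas : ∀ e : ZdEdge 4, Measurable fun ζ : ↥Λ → G => V ζ e := by
    intro e
    simp only [hVapply]
    have hgl : Measurable fun ζ : ↥Λ → G => glueWith Λ ζ η₁ e := (measurable_pi_apply e).comp (measurable_glueWith Λ η₁)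
    exact ((hgm e.1).mul hgl).mul (hgm _).inv
  -- the action bound on the gauge-fixed ball
  have hS : ∀ ζ : ↥Λ → G, (∀ ℓ : ↥Λ, ℓ.1 ∉ T → ‖ρ (V ζ ℓ.1) - 1‖ ≤ r) →
      wilsonBoundaryAction ρ Λ (glueWith Λ ζ η₁) ≤ 8 * r ^ 2 * (plaquettesTouching Λ).card := by
    intro ζ hζ
    have hinv : wilsonBoundaryAction ρ Λ (V ζ) = wilsonBoundaryAction ρ Λ (glueWith Λ ζ η₁) :=
      wilsonBoundaryAction_gaugeTransformZd ρ Λ (g ζ) _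
    rw [← hinv]
    refine ThermalFloor.wilsonBoundaryAction_le_of_forall_norm_le ρ hρU Λ fun e => ?_
    by_cases he : e ∈ Λ
    · by_cases heT : e ∈ T
      · rw [hVT ζ e heT, map_one, sub_self, norm_zero]; exact hr.le
      · exact hζ ⟨e, he⟩ heT
    · rw [hVext ζ e he, map_one, sub_self, norm_zero]; exact hr.le
  -- the split `G^Λ ≃ G^T × G^{Λ∖T}`
  let p : ↥Λ → Prop := fun ℓ => ℓ.1 ∈ T
  set e := MeasurableEquiv.piEquivPiSubtypeProd (fun _ : ↥Λ => G) p with he_def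
  set πT : Measure ({ℓ : ↥Λ // p ℓ} → G) := Measure.pi fun _ => μ with hπT
  set πN : Measure ({ℓ : ↥Λ // ¬p ℓ} → G) := Measure.pi fun _ => μ with hπN
  haveI : IsProbabilityMeasure πT := by rw [hπT]; infer_instance
  haveI : IsProbabilityMeasure πN := by rw [hπN]; infer_instance
  have he : MeasurePreserving e π₀ (πT.prod πN) := by
    rw [hπ₀, hπT, hπN, he_def]
    exact measurePreserving_piEquivPiSubtypeProd (fun _ : ↥Λ => μ) p
  have hesymm_apply : ∀ (q : ({ℓ : ↥Λ // p ℓ} → G) × ({ℓ : ↥Λ // ¬p ℓ} → G)) (ℓ : ↥Λ),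
      e.symm q ℓ = if h : p ℓ then q.1 ⟨ℓ, h⟩ else q.2 ⟨ℓ, h⟩ := fun q ℓ => rfl
  -- the shear in the free coordinates
  set sh : ({ℓ : ↥Λ // p ℓ} → G) → ({ℓ : ↥Λ // ¬p ℓ} → G) → ({ℓ : ↥Λ // ¬p ℓ} → G) :=
    fun t w => fun ℓ => V (e.symm (t, w)) ℓ.1.1 with hsh
  -- `g` along the fibre `{t} × G^{Λ∖T}` is constant
  have hgconst : ∀ (t : {ℓ : ↥Λ // p ℓ} → G) (w : {ℓ : ↥Λ // ¬p ℓ} → G), g (e.symm (t, w)) = g (e.symm (t, fun _ => 1)) := by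
    intro t w
    refine hgT _ _ fun ℓ hℓ => ?_
    rw [hesymm_apply, hesymm_apply, dif_pos hℓ, dif_pos hℓ]
  have hsh_eq : ∀ (t : {ℓ : ↥Λ // p ℓ} → G) (w : {ℓ : ↥Λ // ¬p ℓ} → G), sh t w =
      fun ℓ => g (e.symm (t, fun _ => 1)) ℓ.1.1.1 * w ℓ * (g (e.symm (t, fun _ => 1)) (ℓ.1.1.1 + Pi.single ℓ.1.1.2 1))⁻¹ := by
    intro t w
    funext ℓ
    simp only [hsh]
    rw [hVapply, hgconst t w, glueWith_apply_mem _ _ _ ℓ.1.2, hesymm_apply, dif_neg ℓ.2]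
  have hsh_mp : ∀ t : {ℓ : ↥Λ // p ℓ} → G, MeasurePreserving (sh t) πN πN := by
    intro t
    rw [show sh t = fun w => fun ℓ => g (e.symm (t, fun _ => 1)) ℓ.1.1.1 * w ℓ *
        (g (e.symm (t, fun _ => 1)) (ℓ.1.1.1 + Pi.single ℓ.1.1.2 1))⁻¹ from funext (hsh_eq t), hπN]
    exact measurePreserving_conj_pi _ _
  have hsh_meas : Measurable (Function.uncurry sh) := by
    refine measurable_pi_iff.2 fun ℓ => ?_
    show Measurable fun q : ({ℓ : ↥Λ // p ℓ} → G) × ({ℓ : ↥Λ // ¬p ℓ} → G) => V (e.symm (q.1, q.2)) ℓ.1.1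
    exact (hVmeas ℓ.1.1).comp e.symm.measurable
  have hskew : MeasurePreserving (fun q : ({ℓ : ↥Λ // p ℓ} → G) × ({ℓ : ↥Λ // ¬p ℓ} → G) => (q.1, sh q.1 q.2))
      (πT.prod πN) (πT.prod πN) :=
    MeasurePreserving.skew_product (f := id) (MeasurePreserving.id πT) hsh_meas
      (Filter.Eventually.of_forall fun t => (hsh_mp t).map_eq)
  -- the measure-preserving map `Θ` on the fibre
  set Θ : (↥Λ → G) → (↥Λ → G) := fun ζ => e.symm ((e ζ).1, sh (e ζ).1 (e ζ).2) with hΘ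
  have hΘ_mp : MeasurePreserving Θ π₀ π₀ := by
    have h := (he.symm.comp hskew).comp he
    have hΘeq : Θ = (⇑e.symm ∘ fun q => (q.1, sh q.1 q.2)) ∘ ⇑e := by
      funext ζ; simp only [hΘ, Function.comp_apply]
    rw [hΘeq]; exact h
  -- the box in the free coordinates
  set Ball : Set G := {x : G | ‖ρ x - 1‖ ≤ r} with hBall
  have hBallm : MeasurableSet Ball :=
    (isClosed_le ((continuous_norm.comp (hρ.sub continuous_const))) continuous_const).measurableSet
  set A : Set (↥Λ → G) := Set.pi Set.univ fun ℓ : ↥Λ => if p ℓ then Set.univ else Ball with hA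
  have hAm : MeasurableSet A := MeasurableSet.univ_pi fun ℓ => by
    by_cases h : p ℓ
    · simp only [if_pos h]; exact MeasurableSet.univ
    · simp only [if_neg h]; exact hBallm
  -- `π₀(A) = φ^{#(Λ∖T)}`
  set φ : ℝ := μ.real Ball with hφdef
  have hπA : π₀.real A = φ ^ (Λ \ T).card := by
    rw [measureReal_def, hA, hπ₀, Measure.pi_pi]
    have hfac : ∀ ℓ : ↥Λ, μ (if p ℓ then Set.univ else Ball) = if p ℓ then 1 else μ Ball := by
      intro ℓ; split_ifs <;> simp [measure_univ]
    simp_rw [hfac]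
    rw [Finset.prod_ite, Finset.prod_const_one, one_mul, Finset.prod_const, ENNReal.toReal_pow, ← measureReal_def]
    congr 1
    -- `#{ℓ : ↥Λ | ℓ.1 ∉ T} = #(Λ ∖ T)`
    have h1 : (Finset.univ.filter fun ℓ : ↥Λ => ¬p ℓ) = (Λ \ T).attach.map
        ⟨fun ℓ => ⟨ℓ.1, (Finset.mem_sdiff.1 ℓ.2).1⟩, fun a b h => Subtype.ext (by
          have h' := congrArg Subtype.val h; exact h')⟩ := by
      ext ℓ
      simp only [Finset.mem_filter, Finset.mem_univ, true_and, Finset.mem_map, Finset.mem_attach, Function.Embedding.coeFn_mk,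
        Subtype.exists, Finset.mem_sdiff, p]
      constructor
      · intro h; exact ⟨ℓ.1, ⟨ℓ.2, h⟩, Subtype.ext rfl⟩
      · rintro ⟨a, ⟨haΛ, haT⟩, hal⟩; rw [← hal]; exact haT
    rw [h1, Finset.card_map, Finset.card_attach]
  -- on `Θ⁻¹ A` the action is small
  have hΘA : ∀ ζ : ↥Λ → G, Θ ζ ∈ A → wilsonBoundaryAction ρ Λ (glueWith Λ ζ η₁) ≤ 8 * r ^ 2 * (plaquettesTouching Λ).card := by
    intro ζ hζ
    refine hS ζ fun ℓ hℓ => ?_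
    have h : Θ ζ ℓ ∈ Ball := by
      have h' : Θ ζ ℓ ∈ (if p ℓ then Set.univ else Ball) := hζ ℓ (Set.mem_univ _)
      have hif : (if p ℓ then Set.univ else Ball) = Ball := if_neg hℓ
      rw [hif] at h'
      exact h'
    -- `Θ ζ ℓ = V ζ ℓ.1`
    have hΘℓ : Θ ζ ℓ = V ζ ℓ.1 := by
      simp only [hΘ]
      rw [hesymm_apply, dif_neg hℓ]
      simp only [hsh]
      congr 1
      exact e.symm_apply_apply ζ
    rw [hΘℓ] at h
    exact h
  -- integrate
  have hSc : Continuous fun ζ : ↥Λ → G => wilsonBoundaryAction ρ Λ (glueWith Λ ζ η₁) :=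
    (continuous_wilsonBoundaryAction ρ hρ Λ).comp ((continuous_glueWith_prod Λ).comp (Continuous.prodMk_right η₁))
  obtain ⟨C, hC⟩ : ∃ C, ∀ ζ : ↥Λ → G, |wilsonBoundaryAction ρ Λ (glueWith Λ ζ η₁)| ≤ C := by
    obtain ⟨ζ₀, -, hζ₀⟩ := isCompact_univ.exists_isMaxOn Set.univ_nonempty (continuous_abs.comp hSc).continuousOn
    exact ⟨_, fun ζ => hζ₀ (Set.mem_univ ζ)⟩
  have hint : Integrable (fun ζ : ↥Λ → G => Real.exp (-β * wilsonBoundaryAction ρ Λ (glueWith Λ ζ η₁))) π₀ :=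
    Integrable.of_bound (Real.measurable_exp.comp (hSc.measurable.const_mul _)).aestronglyMeasurable (Real.exp (|β| * C))
      (ae_of_all _ fun ζ => by
        rw [Real.norm_eq_abs, Real.abs_exp]
        refine Real.exp_le_exp.2 ?_
        have h1 : |(-β) * wilsonBoundaryAction ρ Λ (glueWith Λ ζ η₁)| ≤ |β| * C := by
          rw [abs_mul, abs_neg]; gcongr; exact hC ζ
        exact (le_abs_self _).trans h1)
  set ε : ℝ := 8 * r ^ 2 * (plaquettesTouching Λ).card with hε
  have hpre : MeasurableSet (Θ ⁻¹' A) := hΘ_mp.measurable hAm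
  have hlow : Real.exp (-β * ε) * π₀.real (Θ ⁻¹' A) ≤ ∫ ζ, Real.exp (-β * wilsonBoundaryAction ρ Λ (glueWith Λ ζ η₁)) ∂π₀ := by
    have hind : ∫ ζ, (Θ ⁻¹' A).indicator (fun _ => Real.exp (-β * ε)) ζ ∂π₀ = Real.exp (-β * ε) * π₀.real (Θ ⁻¹' A) := by
      rw [integral_indicator_const _ hpre, smul_eq_mul, mul_comm]
    rw [← hind]
    refine integral_mono ((integrable_const _).indicator hpre) hint fun ζ => ?_
    by_cases hζ : ζ ∈ Θ ⁻¹' A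
    · rw [Set.indicator_of_mem hζ]
      refine Real.exp_le_exp.2 ?_
      have := hΘA ζ hζ
      nlinarith
    · rw [Set.indicator_of_notMem hζ]
      exact (Real.exp_pos _).le
  have hmeasA : π₀.real (Θ ⁻¹' A) = φ ^ (Λ \ T).card := by
    rw [← hπA, measureReal_def, measureReal_def, hΘ_mp.measure_preimage hAm.nullMeasurableSet]
  rw [hmeasA] at hlow
  rwa [show -β * ε = -(8 * β * r ^ 2 * (plaquettesTouching Λ).card) by rw [hε]; ring] at hlow

end Gauge

end Summit.QuantumFields.YangMills.Cruxes.UVSeamRec.ClassicalResponse.ColdWall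

end
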